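import Literature.AlgebraicGeometry.HodgeTheory.FermatInductiveClaimsDischargedLeaves
import Literature.AlgebraicGeometry.HodgeTheory.HypersurfaceResidueFormDef
import Literature.AlgebraicGeometry.HodgeTheory.HypersurfaceComplexPoints
import Literature.AlgebraicGeometry.HodgeTheory.HodgeModelConnected
import HarnessLib

/-!
# Aoki–Shioda (2.1) from the absence of `χ_β`-eigen holomorphic `2`-forms on a CONCRETE model of the Fermat surface

Family `hodge`, layer `Literature/AlgebraicGeometry/HodgeTheory`. PROOF FILE (theorems only; no
definition, no named fact — D-0026) on the path of the named fact
`AokiShioda1983_eigenline_le_neronSeveri` (`FermatSurfaceNeronSeveriEigenlines`; Aoki–Shioda 1983,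
§2 (2.1): the Hodge eigenlines `V(α)`, `α ∈ 𝔅²ₘ`, of the Fermat surface are algebraic).

The tree reduces the fact (`AokiShioda1983_eigenline_le_neronSeveri_holds_of_eigenforms`,
`FermatInductiveClaimsDischargedLeaves`: Lefschetz `(1,1)` is the theorem
`lefschetzOneOne_rational_holds`) to ONE analytic statement `hforms` about an abstract Hodge model
`A` of `X²ₘ = fermatHypersurface 2 m`: no non-zero smooth closed `(2,0)`-form `η` on `A.carrier`
with `(g_a^an)^* η = χ_β(a) η` (`a ∈ μₘ⁴`, `g_a^an = HodgeModel.anMap A A (diagonalAut …)`) for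
`β ∈ 𝔅²ₘ`. This file strips the scheme-theoretic layer off that statement: it is implied by
(`AokiShioda1983_eigenline_le_neronSeveri_holds_of_modelEigenforms`) the same vanishing for every
**concrete holomorphic model** of the Fermat surface in the sense of the residue files
(`HypersurfaceResidueForms`, `HypersurfaceResidueFormDef`): a compact connected complex surface `M`
(holomorphic atlas charted on `E`, `dim_ℂ E = 2`) with a topological embedding
`ψ : M → ℙ(ℂ⁴)` onto `V(x₀ᵐ + x₁ᵐ + x₂ᵐ + x₃ᵐ)` whose affine coordinates are holomorphic
(`HasHolomorphicCoords`), and holomorphic self-maps `Φ_a : M → M`, `a ∈ μₘ⁴`, with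
`ψ (Φ_a x) = [a • x̃]` for `ψ x = [x̃]`. The passage `A ↦ (A.carrier, ψ = pt ∘ A.toComplexPoints,
Φ_a = g_a^an)` is the one of `Hartshorne1977_hypersurface_geometricGenus_pos_of` /
`PlaneCubicFirstBetti`: `hypersurface_complexPoints` (embedding onto `V(F)`, regular affine
coordinates), `IsAnalytification.mdifferentiableOn_evalOrZero` (regular functions are holomorphic,
Serre GAGA §2), `HodgeModel.mdifferentiable_anMap` (`g_a^an` is holomorphic, GAGA §2 n°5),
`HodgeModel.toComplexPoints_anMap` with `hypersurfacePoint_diagonalMap` (`g_a` is `[x] ↦ [a • x]`),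
`HodgeModel.compactSpace_carrier`, `HodgeModel.connectedSpace_carrier`.

So the residual obligation of `AokiShioda1983_eigenline_le_neronSeveri_holds` is now a statement of
complex analysis alone (hypothesis `hmodel`): in print, the holomorphic `2`-forms of the Fermat
surface are the residues `Res(x^c Ω/F)`, `Σ cᵢ = m − 4`, with characters `(c₀+1, …, c₃+1)` of
length `1`, so a `χ_β`-eigen holomorphic `2`-form with `|β| = 2` vanishes (Shioda 1979, (1.7);
Griffiths residues, Voisin II §6.1).

## References

* [AokiShioda1983] N. Aoki, T. Shioda, Generators of the Néron–Severi group of a Fermat surface,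
  Progr. Math. 35 (1983) 1–12, §2 (2.1).
* [Shioda1979HodgeFermat] T. Shioda, The Hodge conjecture for Fermat varieties, Math. Ann. 245
  (1979) 175–184, §1 (1.7).
* [VoisinHodgeII2003] C. Voisin, Hodge Theory and Complex Algebraic Geometry II (2003), §6.1.1,
  §6.1.3.
* [SerreGAGA1956] J.-P. Serre, Géométrie algébrique et géométrie analytique, Ann. Inst. Fourier 6
  (1956), §2 n°5–6.
-/

noncomputable section

open scoped Manifold ContDiff Topology LinearAlgebra.Projectivization
open CategoryTheory AlgebraicGeometry

namespace Literature.AlgebraicGeometry.HodgeTheory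

open Literature.AlgebraicGeometry.Motives Literature.NumberTheory.Transcendental
  Literature.Geometry.Kaehler

/-- **`AokiShioda1983_eigenline_le_neronSeveri` from the absence of `χ_β`-eigen closed
`(2,0)`-forms on every concrete holomorphic model of the Fermat surface.** Hypothesis `hmodel`:
for every `m ≥ 1`, every compact connected complex surface `M` (charted on `E`, `dim_ℂ E = 2`)
with a topological embedding `ψ` onto `V(Σ xᵢᵐ) ⊂ ℙ(ℂ⁴)` with holomorphic affine coordinates, and
holomorphic maps `Φ_a : M → M` (`a ∈ μₘ⁴`) over `[x] ↦ [a • x]`, every smooth closed `2`-form of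
type `(2,0)` with `Φ_a^* η = χ_β(a) η` for all `a`, `β ∈ 𝔅²ₘ`, vanishes. Conclusion: the named
fact, through `AokiShioda1983_eigenline_le_neronSeveri_holds_of_eigenforms` applied to a Hodge
model `A` of `X²ₘ` (`nonempty_hodgeModel_holds`) read as such a model: `M = A.carrier`,
`ψ = hypersurfacePoint ι ∘ A.toComplexPoints` (`hypersurface_complexPoints`; coordinates holomorphic
by `IsAnalytification.mdifferentiableOn_evalOrZero`), `Φ_a = g_a^an` (`HodgeModel.anMap`,
holomorphic by `HodgeModel.mdifferentiable_anMap`, over `[x] ↦ [a • x]` by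
`hypersurfacePoint_diagonalMap`). In print: `H⁰(X²ₘ, Ω²)` is spanned by the residues
`Res(x^c Ω/F)` of characters of length `1` (Shioda (1.7)).
[cite: AokiShioda1983, §2 (2.1)–(2.2), p. 3] [cite: Shioda1979HodgeFermat, §1 (1.7)]
[cite: VoisinHodgeII2003, §6.1.1 and §6.1.3] [cite: SerreGAGA1956, §2 n°5 (fonctorialité de X^h)] -/
theorem AokiShioda1983_eigenline_le_neronSeveri_holds_of_modelEigenforms
    (hmodel : ∀ (m : ℕ) [NeZero m] (E : Type) [NormedAddCommGroup E] [NormedSpace ℂ E]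
      [FiniteDimensional ℂ E] (M : Type) [TopologicalSpace M] [ChartedSpace E M]
      [IsManifold 𝓘(ℂ, E) ω M] [IsManifold 𝓘(ℝ, E) ∞ M] [T2Space M] [CompactSpace M]
      [ConnectedSpace M], Module.finrank ℂ E = 2 →
      ∀ ψ : M → ℙ ℂ (Fin (2 + 2) → ℂ), Topology.IsEmbedding ψ →
        Set.range ψ = Projectivization.projZeroLocus {fermatPolynomial ℂ 2 m} →
        HasHolomorphicCoords E ψ →
      ∀ Φ : fermatGroup 2 m → M → M, (∀ a, MDifferentiable 𝓘(ℂ, E) 𝓘(ℂ, E) (Φ a)) →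
        (∀ (a : fermatGroup 2 m) (x : M), ψ (Φ a x) =
          Projectivization.mk ℂ ((a : Fin (2 + 2) → ℂˣ) • (ψ x).rep)
            ((smul_ne_zero_iff_ne (a : Fin (2 + 2) → ℂˣ)).mpr (Projectivization.rep_nonzero _))) →
      ∀ β : Fin 4 → ZMod m, FermatCharacter.IsHodge β →
      ∀ η : MForm 𝓘(ℝ, E) M ℂ 2, IsSmoothForm η → IsClosedForm η → IsOfType 2 0 η →
        (∀ a : fermatGroup 2 m,
          η.pullback 𝓘(ℝ, E) (Φ a) = ((fermatCharacter m β a : ℂˣ) : ℂ) • η) →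
        η = 0) :
    AokiShioda1983_eigenline_le_neronSeveri := by
  refine AokiShioda1983_eigenline_le_neronSeveri_holds_of_eigenforms fun m _ ↦ ?_
  have hX : IsSmoothProjective 2 (fermatHypersurface 2 m) :=
    isSmoothProjective_fermatHypersurface (by norm_num) NeZero.one_le
  obtain ⟨A⟩ := nonempty_hodgeModel_holds hX
  refine ⟨A, fun β hβ η hs hc ht heig ↦ ?_⟩
  -- the concrete model `(A.carrier, ψ, Φ)`
  set F : MvPolynomial (Fin (2 + 2)) ℂ := fermatPolynomial ℂ 2 m with hFdef
  obtain ⟨hemb, hrangeψ, hcoord⟩ := hypersurface_complexPoints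
    (SmoothHypersurface.hypersurfaceι F) (isHomogeneous_fermatPolynomial 2 m)
    (SmoothHypersurface.range_hypersurfaceι F)
  haveI : CompactSpace A.carrier := A.compactSpace_carrier hX
  haveI : ConnectedSpace A.carrier := A.connectedSpace_carrier hX
  set ψ : A.carrier → ℙ ℂ (Fin (2 + 2) → ℂ) :=
    hypersurfacePoint (SmoothHypersurface.hypersurfaceι F) ∘ A.toComplexPoints with hψ
  have hψemb : Topology.IsEmbedding ψ :=
    hemb.comp A.isAnalytification.homeomorph.isEmbedding
  have hψrange : Set.range ψ = Projectivization.projZeroLocus {F} := by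
    rw [hψ, Set.range_comp, A.isAnalytification.isHomeomorph.surjective.range_eq, Set.image_univ,
      hrangeψ]
  -- the affine coordinates of `ψ` are holomorphic (regular functions pull back to holomorphic ones)
  have hhol : HasHolomorphicCoords A.model ψ := by
    intro i j
    obtain ⟨U, hU, hs⟩ := hcoord i
    obtain ⟨s, hs⟩ := hs j
    have hhol := A.isAnalytification.mdifferentiableOn_evalOrZero U s
    have hset : ψ ⁻¹' (Projectivization.stdChart i).source =
        A.toComplexPoints ⁻¹' {P | P.pt ∈ (↑U : (fermatHypersurface 2 m).left.Opens)} := by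
      rw [hU, hψ, Set.preimage_comp]
    change MDifferentiableOn 𝓘(ℂ, A.model) 𝓘(ℂ, ℂ) _ (ψ ⁻¹' (Projectivization.stdChart i).source)
    rw [hset]
    exact hhol.congr fun x hx ↦ (hs (A.toComplexPoints x) hx).symm
  -- the holomorphic self-maps `g_a^an`
  set Φ : fermatGroup 2 m → A.carrier → A.carrier := fun a ↦
    HodgeModel.anMap A A (diagonalAut F (fermatGroup_le_diagonalStabilizer m a.2)) with hΦ
  have hΦd : ∀ a, MDifferentiable 𝓘(ℂ, A.model) 𝓘(ℂ, A.model) (Φ a) := fun a ↦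
    HodgeModel.mdifferentiable_anMap A A _ hX hX
  have hΦψ : ∀ (a : fermatGroup 2 m) (x : A.carrier), ψ (Φ a x) =
      Projectivization.mk ℂ ((a : Fin (2 + 2) → ℂˣ) • (ψ x).rep)
        ((smul_ne_zero_iff_ne (a : Fin (2 + 2) → ℂˣ)).mpr (Projectivization.rep_nonzero _)) := by
    intro a x
    simp only [hψ, hΦ, Function.comp_apply, HodgeModel.toComplexPoints_anMap]
    rw [← diagonalMap_apply]
    exact hypersurfacePoint_diagonalMap F _ _
  exact hmodel m A.model A.carrier A.isAnalytification.finrank_eq ψ hψemb hψrange hhol Φ hΦd hΦψ β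
    hβ η hs hc ht heig

end Literature.AlgebraicGeometry.HodgeTheory

end
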